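import Literature.Topology.FourManifolds.DehnSurgery
import Literature.Topology.FourManifolds.DehnSurgeryTwistProofs
import Literature.Topology.FourManifolds.TubeSurgery
import HarnessLib

/-!
# Surgery on a knot is surgery on the one-component framed link

Sibling proof file of `DehnSurgery.lean` (D-0014: named facts `def X : Prop` are discharged as
`theorem X_holds : X`). It discharges

* `Literature.IsIntegralSurgery.isIntegralSurgeryLink_holds : IsIntegralSurgery.isIntegralSurgeryLink` —
  if `Y` is `m`-surgery on the knot `K` (`Literature.Topology.FourManifolds.IsIntegralSurgery`), then `Y` is surgery on the
  one-component link `Link.ofKnot K` with framing `m` (`Literature.Topology.FourManifolds.IsIntegralSurgeryLink`);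
* `Literature.exists_isIntegralSurgery_holds : exists_isIntegralSurgery` — for every knot `K` and every
  `m : ℤ`, `m`-surgery on `K` exists as a closed (compact, Hausdorff, second countable) smooth
  `3`-manifold (see the section *Existence of integral Dehn surgery* at the end of the file).

Source: Gompf–Stipsicz, *4-Manifolds and Kirby Calculus* (1999), §5.3 defines Dehn surgery on
a framed link componentwise, a framed knot being a one-component framed link (likewise Rolfsen,
*Knots and Links* (1976), §9.F–G). With the relational definitions of `DehnSurgery.lean` the
statement is an unfolding, no printed argument being needed: the complement of `Link.ofKnot K`
is the knot complement (`Link.complement_ofKnot`), the tubular neighbourhood `ν` and the two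
gluing embeddings `jA`, `jB` of `IsIntegralSurgery` are reused (`Link.surgeryRel (fun _ ↦ ν) i`
unfolds to `ν.glueRel`, as does `surgeryRel ν`), and every `Pairwise` disjointness condition
over the index type `Unit` is vacuous. The only step is transporting `jA : K.complement → Y`
along the equality of open sets `(Link.ofKnot K).complement = K.complement`, done by
generalising the open set.
-/

open scoped Manifold ContDiff Topology
open Function Set

noncomputable section

namespace Literature.Topology.FourManifolds

section SurgeryDischarge

variable {EY HY : Type*} [NormedAddCommGroup EY] [NormedSpace ℝ EY] [TopologicalSpace HY]
  {IY : ModelWithCorners ℝ EY HY} {Y : Type*} [TopologicalSpace Y] [ChartedSpace HY Y]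

/-- `m`-surgery on a knot `K` is surgery on the one-component framed link `(Link.ofKnot K, m)`:
reuse the tubular neighbourhood `ν` and the two gluing embeddings of `IsIntegralSurgery`,
transporting the embedding of the knot complement along
`(Link.ofKnot K).complement = K.complement`. Gompf–Stipsicz (1999), §5.3; Rolfsen (1976),
§9.F–G. [cite: GompfStipsicz1999, §5.3] -/
theorem IsIntegralSurgery.isIntegralSurgeryLink' {K : Knot} {m : ℤ}
    (h : IsIntegralSurgery IY Y K m) : IsIntegralSurgeryLink IY Y (Link.ofKnot K) (fun _ ↦ m) := by
  obtain ⟨ν, hν, jA, jB, hA, hAo, hB, hBo, hU, hR⟩ := h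
  refine ⟨fun _ ↦ ν, fun _ ↦ hν, fun i j hij ↦ absurd (Subsingleton.elim i j) hij, ?_⟩
  -- Transport along the equality of open sets `(Link.ofKnot K).complement = K.complement`.
  suffices key : ∀ U : TopologicalSpace.Opens
      (Metric.sphere (0 : EuclideanSpace ℝ (Fin 4)) 1), U = K.complement →
      ∃ (jA' : U → Y) (jB' : Unit → solidTorus → Y),
        Manifold.IsSmoothEmbedding (𝓡 3) IY ∞ jA' ∧ IsOpen (range jA') ∧
        (∀ i, Manifold.IsSmoothEmbedding (𝓘(ℝ, EuclideanSpace ℝ (Fin 2)).prod (𝓡 1)) IY ∞ (jB' i)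
          ∧ IsOpen (range (jB' i))) ∧
        range jA' ∪ (⋃ i, range (jB' i)) = univ ∧
        (Pairwise fun i j ↦ Disjoint (range (jB' i)) (range (jB' j))) ∧
        ∀ i (a : U) b, jA' a = jB' i b ↔
          ν.glueRel (a : Metric.sphere (0 : EuclideanSpace ℝ (Fin 4)) 1)
            (b : EuclideanSpace ℝ (Fin 2) × Metric.sphere (0 : EuclideanSpace ℝ (Fin 2)) 1) from
    key _ (Link.complement_ofKnot K)
  rintro U rfl
  refine ⟨jA, fun _ ↦ jB, hA, hAo, fun _ ↦ ⟨hB, hBo⟩, ?_,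
    fun i j hij ↦ absurd (Subsingleton.elim i j) hij, fun _ a b ↦ hR a b⟩
  rwa [iUnion_const]

/-- Discharge of the named fact `IsIntegralSurgery.isIntegralSurgeryLink`: `m`-surgery on a knot
is surgery on the corresponding one-component framed link. Gompf–Stipsicz (1999), §5.3. [cite: GompfStipsicz1999, §5.3] -/
theorem IsIntegralSurgery.isIntegralSurgeryLink_holds :
    IsIntegralSurgery.isIntegralSurgeryLink (IY := IY) (Y := Y) :=
  fun h ↦ h.isIntegralSurgeryLink'

end SurgeryDischarge

/-! ### Existence of integral Dehn surgery (Gompf–Stipsicz §5.3, Rolfsen §9.F)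

Gompf–Stipsicz, *4-Manifolds and Kirby Calculus* (1999), §5.3 (with Rolfsen, *Knots and Links*
(1976), §9.F) define Dehn surgery on a knot `K` in `S³`: remove an open tubular neighbourhood
`ν K ≈ 𝕊 1 × D²` and reglue `𝕊 1 × D²` by a diffeomorphism of the boundary torus; the surgery is
*integral*, with coefficient `m ∈ ℤ`, when the meridian `pt × ∂D²` goes to the push-off of `K`
determined by the framing `m` (equivalently: the new boundary produced by attaching a
`4`-dimensional `2`-handle to `D⁴` along `(K, m)`), and the result is a closed orientable
`3`-manifold. The same definition is Schultens, *Introduction to 3-Manifolds* (2014), Def. 7.3.2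
(remove `η(K)` from `𝕊³` and attach a solid torus so that a meridian goes to a curve of slope
`m/l` on `∂C(K)`; integral surgery is `l = 1`). No source isolates the existence of the surgered
manifold as a numbered theorem — it is the construction itself; the two monographs were not held
by the literature store when this section was written (acquisition requested), and the statement
discharged is the one vendored (and audited) in `DehnSurgery.lean`. In the relational language of
that file (`Literature.IsIntegralSurgery IY Y K m`: `Y` is an open gluing of `S³ ∖ K` and `D̊² × 𝕊 1`
along `surgeryRel ν` for an oriented tubular neighbourhood `ν` of framing `m`) the construction
splits into two results proved in the tree:

* every framing is realised by an oriented tubular neighbourhood —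
  `Literature.Topology.FourManifolds.Knot.exists_tubularNbhd_hasFraming_holds` (`DehnSurgeryTwistProofs.lean`: take any tubular
  neighbourhood, read off its framing `m₀` in the abelianised knot group, and twist it `m - m₀`
  times; Gompf–Stipsicz §4.5, Rolfsen §9.F);
* surgery along the tube of a framed tubular neighbourhood exists as a closed smooth `3`-manifold —
  `Literature.Topology.FourManifolds.exists_isIntegralSurgery_of` (`TubeSurgery.lean`: the pushout `(S³ ∖ K) ∪_glue (D̊² × 𝕊 1)`
  along the polar identification `ν (u, w) ↦ (‖w‖ • u, w/‖w‖)`, `0 < ‖w‖ < 1`, Hausdorff because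
  both core circles are removed, compact as the union of the images of `S³ ∖ ν(𝕊 1 × ½D̊²)` and
  `½D̄² × 𝕊 1`; Kosinski, *Differential Manifolds* (1993), VI.1 for gluing along open subsets).
-/

/-- **Existence of Dehn surgery** — discharge of the named fact `Literature.Topology.FourManifolds.exists_isIntegralSurgery` of
`DehnSurgery.lean`: for every knot `K` and every integer `m`, `m`-surgery on `K` exists as a
closed (compact, Hausdorff, second countable) smooth `3`-manifold `Y` with
`IsIntegralSurgery (𝓡 3) Y K m`. Choose an oriented tubular neighbourhood of framing `m`
(`Knot.exists_tubularNbhd_hasFraming_holds`) and glue `D̊² × 𝕊 1` to `S³ ∖ K` along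
`surgeryRel ν` (`exists_isIntegralSurgery_of`). Gompf–Stipsicz, *4-Manifolds and Kirby Calculus*
(1999), §5.3; Rolfsen, *Knots and Links* (1976), §9.F. [cite: GompfStipsicz1999, §5.3] -/
theorem exists_isIntegralSurgery_holds : exists_isIntegralSurgery :=
  exists_isIntegralSurgery_of Knot.exists_tubularNbhd_hasFraming_holds

end Literature.Topology.FourManifolds
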